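import Literature.Topology.FourManifolds.OneHandleBoundaryStep
import Literature.Topology.FourManifolds.ZeroSphereSurgeryNeck
import Literature.Topology.FourManifolds.ZeroSphereSurgeryNormalisation
import Literature.Topology.FourManifolds.ZeroSphereSurgeryNonorientable
import HarnessLib

/-!
# `0`-surgery along a framed `S⁰` in a connected `3`-manifold with orientable result is
# `· # (S² × S¹)`: discharge of HALF B and of the one-handle step

Topic `Literature/Topology/FourManifolds`.  This file DISCHARGES the named facts

* `isConnectedSum_of_zeroSphereSurgery` (HALF B of the one-handle step, `OneHandleBoundaryStep.lean`):
  the `0`-surgery `Z₂` of a connected smooth `3`-manifold `Z` along a framed `S⁰`, if orientable,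
  is a connected sum `Z # (S² × S¹)` (`isConnectedSum_of_zeroSphereSurgery_holds`);
* hence the one-handle step `isConnectedSum_boundary_of_isHandleAttachment_one` of
  `OneHandlebodyBoundarySum.lean` (`…_holds`) and Kirby's sentence `∂(♮ⁿ S¹ × B³) = #ⁿ(S² × S¹)`,
  `exists_oneHandlebody_four_boundary_isSphereTwoProdCircleSum` (`…_holds`).

A. A. Kosinski, *Differential Manifolds* (1993), VI §9 with VI (3.1)–(3.2), (6.6); J. Milnor,
*Lectures on the h-cobordism theorem* (1965), Def. 3.11, Thm. 3.13; R. C. Kirby, *The topology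
of 4-manifolds* (1989), Ch. I §2, p. 8.

## Proof of HALF B (assembly of the tree's pieces)

Take a chart `Φ` of `Z` onto `ℝ³` (`exists_mem_maximalAtlas_target_eq_univ`) and the two standard
framing discs `Φ⁻¹ ∘ discNear`, `Φ⁻¹ ∘ discFar` of the local model
(`ZeroSphereSurgeryModelGluing.lean` §9, smooth embeddings with disjoint ranges,
`ZeroSphereSurgeryModelDiscs.lean`).  By the disc theorem
(`FramedSphereFamily.IsSurgery.exists_isOpenGluing_stdRel`, `ZeroSphereSurgeryNormalisation.lean`)
`Z₂` is the open gluing of `Z ∖ {Φ⁻¹ nearCentre, Φ⁻¹ 0}` and the neck along Milnor's relation for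
`Φ⁻¹ ∘ discNear` and `Φ⁻¹ ∘ discFar ∘ ρ`, `ρ = id` or `ρ = -id`.  If `ρ = id` this is the
standard-position surgery, a connected sum `Z # (S² × S¹)` by the neck presentation
(`isConnectedSum_of_isOpenGluingWith_stdRel_chart`, `ZeroSphereSurgeryNeck.lean`).  If `ρ = -id`
(`det = -1`), the result would be non-orientable (the two discs have opposite Jacobian signs in
the chart), so the reflected framing is excluded by the orientability of `Z₂`
(`ZeroSphereModel.not_isOrientable_of_isOpenGluing_stdRel_twisted`,
`ZeroSphereSurgeryNonorientable.lean`; the same obstruction in intrinsic form: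
`ZeroSphereOrientation.not_smoothOrientation_of_reflected_foot`, `ZeroSphereSurgeryOrientation.lean`;
Kosinski VI (6.6)).

Everything here is proved; no definitions and no named facts are introduced.

## References

* A. A. Kosinski, *Differential Manifolds* (1993), VI (3.1), (6.6), §9. [Kosinski1993]
* J. Milnor, *Lectures on the h-cobordism theorem* (1965), Def. 3.11, Thm. 3.13.
  [MilnorHCobordism1965]
* R. C. Kirby, *The topology of 4-manifolds*, LNM 1374 (1989), Ch. I §2, p. 8. [Kirby1989]
-/

open scoped Manifold ContDiff Topology
open Set Function Metric Module

noncomputable section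

namespace Literature.Topology.FourManifolds

open ZeroSphereModel

/-- The antipodal map `-id` of `ℝ³` has determinant `-1 < 0`. [folklore] -/
theorem det_neg_three_lt_zero :
    LinearMap.det ((LinearIsometryEquiv.neg ℝ (E := EuclideanSpace ℝ (Fin 3))).toLinearEquiv :
      EuclideanSpace ℝ (Fin 3) →ₗ[ℝ] EuclideanSpace ℝ (Fin 3)) < 0 := by
  have e : ((LinearIsometryEquiv.neg ℝ (E := EuclideanSpace ℝ (Fin 3))).toLinearEquiv :
      EuclideanSpace ℝ (Fin 3) →ₗ[ℝ] EuclideanSpace ℝ (Fin 3)) = (-1 : ℝ) • LinearMap.id := by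
    ext v i
    simp
  rw [e, LinearMap.det_smul, LinearMap.det_id, mul_one,
    show Module.finrank ℝ (EuclideanSpace ℝ (Fin 3)) = 3 from finrank_euclideanSpace_fin]
  norm_num

/-- **HALF B of the one-handle step holds**: the `0`-surgery of a connected smooth `3`-manifold
`Z` along a framed `S⁰`, if orientable, is a connected sum `Z # (S² × S¹)` (Kosinski 1993, VI §9
with (3.1), (6.6); see the module docstring for the assembly).
[cite: Kosinski1993, VI §9, (3.1), (6.6)] [cite: MilnorHCobordism1965, Def. 3.11, Thm. 3.13] -/
theorem isConnectedSum_of_zeroSphereSurgery_holds : isConnectedSum_of_zeroSphereSurgery := by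
  intro Z _ _ _ _ _ νS Z₂ _ _ _ _ hS ho
  ------------------------------------------------------------------------------------------
  -- Step 1: a chart of `Z` onto `ℝ³` and the two standard framing discs
  ------------------------------------------------------------------------------------------
  haveI : Nonempty Z := ⟨νS.toFun () (⟨EuclideanSpace.single 0 1, single_mem_sphere_zero⟩, 0)⟩
  obtain ⟨Φ, hΦatlas, -, hΦt, -⟩ :=
    exists_mem_maximalAtlas_target_eq_univ (E := EuclideanSpace ℝ (Fin 3)) (Classical.arbitrary Z)
  have hΦ : ContMDiffOn (𝓡 3) (𝓡 3) ∞ Φ Φ.source := contMDiffOn_of_mem_maximalAtlas hΦatlas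
  have hΦ' : ContMDiff (𝓡 3) (𝓡 3) ∞ Φ.symm := by
    have h := contMDiffOn_symm_of_mem_maximalAtlas hΦatlas
    rw [hΦt] at h
    exact contMDiffOn_univ.1 h
  obtain ⟨D, hD⟩ := exists_connectedSumSphereData Φ hΦt hΦ hΦ'
  have hiD : D.i₁ = Φ.symm := by rw [ConnectedSumSphereData.i₁_def, hD]
  have hi : Manifold.IsSmoothEmbedding (𝓡 3) (𝓡 3) ∞ Φ.symm := hiD ▸ D.isSmoothEmbedding_i₁
  have hinj : Injective Φ.symm := hi.isEmbedding.injective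
  have hio : IsOpen (range Φ.symm) := by
    rw [← image_univ, ← hΦt, Φ.symm_image_target_eq_source]
    exact Φ.open_source
  set Dp : EuclideanSpace ℝ (Fin 3) → Z := Φ.symm ∘ discNear with hDp
  set Dm : EuclideanSpace ℝ (Fin 3) → Z := Φ.symm ∘ discFar with hDm
  obtain ⟨hDpe, -⟩ := isSmoothEmbedding_comp_of_isOpen_range_and hi hio
    isSmoothEmbedding_discNear.1 isSmoothEmbedding_discNear.2
  obtain ⟨hDme, -⟩ := isSmoothEmbedding_comp_of_isOpen_range_and hi hio
    isSmoothEmbedding_discFar.1 isSmoothEmbedding_discFar.2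
  have hdisj : Disjoint (range Dp) (range Dm) := by
    rw [hDp, hDm, range_comp, range_comp]
    exact (disjoint_image_iff hinj).2 disjoint_range_discNear_discFar
  ------------------------------------------------------------------------------------------
  -- Step 2: normalisation by the disc theorem
  ------------------------------------------------------------------------------------------
  set A : TopologicalSpace.Opens Z :=
    ⟨({Φ.symm nearCentre, Φ.symm 0} : Set Z)ᶜ, (Set.toFinite _).isClosed.isOpen_compl⟩ with hA_def
  have hA : (A : Set Z) = ({Φ.symm nearCentre, Φ.symm 0} : Set Z)ᶜ := rfl
  have hA' : (A : Set Z) = ({Dp 0, Dm 0} : Set Z)ᶜ := by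
    rw [hA, hDp, hDm, Function.comp_apply, Function.comp_apply, discNear_zero, discFar_zero]
  set r : EuclideanSpace ℝ (Fin 3) ≃ₗᵢ[ℝ] EuclideanSpace ℝ (Fin 3) :=
    LinearIsometryEquiv.neg ℝ (E := EuclideanSpace ℝ (Fin 3)) with hr_def
  have hr : LinearMap.det (r.toLinearEquiv :
      EuclideanSpace ℝ (Fin 3) →ₗ[ℝ] EuclideanSpace ℝ (Fin 3)) < 0 := det_neg_three_lt_zero
  have hrr : ∀ x, r (r x) = x := fun x => by rw [hr_def]; simp
  obtain ⟨ρ, hρ, jA, jB, hjA, hjAo, hjB, hjBo, hU, hR⟩ :=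
    hS.exists_isOpenGluing_stdRel hDpe hDme hdisj r hr hrr A hA'
  rcases hρ with rfl | rfl
  · ----------------------------------------------------------------------------------------
    -- Step 3a: standard position — the neck presentation
    ----------------------------------------------------------------------------------------
    exact isConnectedSum_of_isOpenGluingWith_stdRel_chart Φ hΦt hΦ hΦ' hA
      ⟨hjA, hjAo, hjB, hjBo, hU, fun a b => (hR a b).trans Iff.rfl⟩
  · ----------------------------------------------------------------------------------------
    -- Step 3b: the reflected framing is excluded by the orientability of `Z₂`
    ----------------------------------------------------------------------------------------
    exact (not_isOrientable_of_isOpenGluing_stdRel_twisted Φ hΦt hΦ hΦ' r hr hA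
      ⟨jA, jB, hjA, hjAo, hjB, hjBo, hU, fun a b => (hR a b).trans Iff.rfl⟩ ho).elim

/-- **The one-handle step holds**: attaching an orientable `1`-handle to a compact connected
`4`-manifold with connected boundary changes the boundary by `# (S² × S¹)` — the named fact
`isConnectedSum_boundary_of_isHandleAttachment_one` of `OneHandlebodyBoundarySum.lean`, §3, from
its two halves (`isConnectedSum_boundary_of_isHandleAttachment_one_of_halfB`).
[cite: Kosinski1993, VI §9, (3.1), (6.6)] [cite: Kirby1989, Ch. I §2, p. 8] -/
theorem isConnectedSum_boundary_of_isHandleAttachment_one_holds :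
    isConnectedSum_boundary_of_isHandleAttachment_one :=
  isConnectedSum_boundary_of_isHandleAttachment_one_of_halfB isConnectedSum_of_zeroSphereSurgery_holds

/-- **Kirby's sentence `∂(♮ⁿ S¹ × B³) = #ⁿ(S² × S¹)` holds** (the named fact
`exists_oneHandlebody_four_boundary_isSphereTwoProdCircleSum` of `OneHandlebodyBoundarySum.lean`, §5):
for every `n` some compact connected orientable `4`-dimensional `(1,n)`-handlebody has a boundary
datum which is `#ⁿ(S² × S¹)` in the sense of `IsSphereTwoProdCircleSum n`.
[cite: Kirby1989, Ch. I §2, p. 8] [cite: Kosinski1993, VI (11.4)] -/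
theorem exists_oneHandlebody_four_boundary_isSphereTwoProdCircleSum_holds :
    exists_oneHandlebody_four_boundary_isSphereTwoProdCircleSum :=
  exists_oneHandlebody_four_boundary_isSphereTwoProdCircleSum_of_step
    isConnectedSum_boundary_of_isHandleAttachment_one_holds

end Literature.Topology.FourManifolds

end
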